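import Summits.Schanuel.Schanuel.Theorems.RoySmallValueDirichletGap.Negative.DirichletEdgeBoxLemmas

/-!
# `RoySmallValueDirichletGap` is sharp: below the Dirichlet edge the hypothesis holds at EVERY point
(tightness lemma for crux `stmt-Schanuel-1050`)

Roy 2013 (Mathematika 59 = arXiv:1301.0663), p. 3: "For any choice of `(ξ, η) ∈ 𝒢` and `β, τ, ν` with
`0 ≤ τ < 2`, `β > max{1, τ}` and `ν < 2 + β − τ`, a simple application of [Dirichlet's box] principle
shows the existence of a sequence of non-zero polynomials `(P_D)_{D ≥ 1}` in `ℤ[X₁, X₂]` with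
`deg(P_D) ≤ D` and `‖P_D‖ ≤ exp(D^β)` satisfying (1.2) for each large enough `D`."

We kernel-check this in the range of the crux
`Summit.Schanuel.Schanuel.Theses.RoyCriterion.RoySmallValueDirichletGap` (`1 ≤ τ < 2`, `β > τ`):
for EVERY point `(ξ, η) ∈ ℂ²` and every `ν < 2 + β − τ`, for all large `D` there is
`0 ≠ P ∈ ℤ[X₁, X₂]` with `deg P ≤ D`, height `≤ exp(D^β)` and `|𝒟₁ⁱP(ξ, η)| ≤ exp(−D^ν)` for all
`i < 3⌊D^τ⌋` (`hyp_below_edge`). Consequently the lower bound `2 + β − τ < ν` of the crux cannot be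
lowered AT ALL: for every `ν < 2 + β − τ` the crux-shaped implication fails at the transcendental point
`(e, 1)` (`roySmallValueDirichletGap_false_below_edge`), and the crux with its `ν`-window replaced by
any window reaching below the edge is false (`roySmallValueDirichletGap_false_of_edge_lowered`).

Proof (Dirichlet's box principle, as in the paper): coefficient vectors
`c : {0..H}² → {0..A}` (`H = ⌊D/2⌋`, `A = ⌊e^{D^β}⌋`) of `P_c = ∑ c_{ab} X₁ᵃX₂ᵇ`; the values
`vᵢ(c) = 𝒟₁ⁱP_c(ξ, η)`, `i < M = 3⌊D^τ⌋`, are bounded by `B = (H+1)² A M! R^D`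
(`R = (|ξ|+1)(e|η|+1)`, Cauchy's estimate on the unit circle for `z ↦ X₁ᵃX₂ᵇ(ξ+z, ηe^z)`); cutting
the box `[−B, B]^{2M} ⊂ ℝ^{2M} ≅ ℂ^M` into cells of side `ε = e^{−D^ν}/2` gives
`(2⌈B/ε⌉+1)^{2M} < (A+1)^{(H+1)²}` cells for large `D` — this is where `τ < 2`, `β > 2τ − 2`,
`β > τ − 1` and `ν < 2 + β − τ` enter — so two distinct vectors share a cell and their difference
`P` has height `≤ A`, degree `≤ 2H ≤ D` and `|𝒟₁ⁱP(ξ, η)| < 2ε`. Everything is proved; no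
definitions, no named facts.
-/

noncomputable section

namespace Summit.Schanuel.Schanuel.Theorems.RoySmallValueDirichletGapDirichlet

open MvPolynomial Filter Complex Finset Metric
open Literature.NumberTheory.Transcendental

/-! ### The box principle -/

set_option maxHeartbeats 400000 in
/-- **Dirichlet's box principle below the edge** (Roy 2013, p. 3, in the range of the crux): for
EVERY `(ξ, η) ∈ ℂ²`, `1 ≤ τ < 2`, `β > τ` and `ν < 2 + β − τ`, for all large `D` there is
`0 ≠ P ∈ ℤ[X₁, X₂]` with `deg P ≤ D`, height `≤ exp(D^β)` and `|𝒟₁ⁱP(ξ, η)| ≤ exp(−D^ν)` for all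
`i < 3⌊D^τ⌋`. [cite: Roy2013, p. 3 (Dirichlet's box principle: "if it is possible to reduce the lower
bound on ν … it could not be by more than (τ−1)(2−τ)/(β+1−τ)")] -/
theorem hyp_below_edge (ξ η : ℂ) {β τ ν : ℝ} (h1 : 1 ≤ τ) (h2 : τ < 2) (hβ : τ < β)
    (hν : ν < 2 + β - τ) :
    ∀ᶠ D : ℕ in atTop, ∃ P : MvPolynomial (Fin 2) ℤ, P ≠ 0 ∧ P.totalDegree ≤ D ∧
      (mvPolyHeight P : ℝ) ≤ Real.exp ((D : ℝ) ^ β) ∧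
      ∀ i : ℕ, i < 3 * ⌊(D : ℝ) ^ τ⌋₊ → ‖aeval ![ξ, η] (royD^[i] P)‖ ≤ Real.exp (-(D : ℝ) ^ ν) := by
  -- the constant `R ≥ 1`
  set R : ℝ := (‖ξ‖ + 1) * (‖η‖ * Real.exp 1 + 1) with hR
  have hR1 : 1 ≤ R := by
    have hx1 : 1 ≤ ‖ξ‖ + 1 := by have := norm_nonneg ξ; linarith
    have hy1 : 1 ≤ ‖η‖ * Real.exp 1 + 1 := by
      have := mul_nonneg (norm_nonneg η) (Real.exp_pos 1).le; linarith
    exact one_le_mul_of_one_le_of_one_le hx1 hy1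
  have hlogR : 0 ≤ Real.log R := Real.log_nonneg hR1
  -- asymptotics: seven terms, each eventually ≤ D^{2+β}/56
  have hE : (0 : ℝ) < 1 / 56 := by norm_num
  have hev := ((((((eventually_nat_rpow_le (6 * Real.log 8) (show τ < 2 + β by linarith) hE).and
    (eventually_nat_rpow_le 12 (show τ + 1 < 2 + β by linarith) hE)).and
    (eventually_nat_rpow_le 6 (show τ + β < 2 + β by linarith) hE)).and
    (eventually_nat_rpow_le (18 * Real.log 3) (show 2 * τ < 2 + β by linarith) hE)).and
    (eventually_nat_rpow_log_le (show 2 * τ < 2 + β by linarith) (show (0:ℝ) ≤ 18 * τ by linarith) hE)).and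
    (eventually_nat_rpow_le (6 * Real.log R) (show τ + 1 < 2 + β by linarith) hE)).and
    (eventually_nat_rpow_le 6 (show τ + ν < 2 + β by linarith) hE)
  filter_upwards [hev, eventually_ge_atTop 1] with D hD hD1
  obtain ⟨⟨⟨⟨⟨⟨e1, e2⟩, e3⟩, e4⟩, e5⟩, e6⟩, e7⟩ := hD
  -- notation
  have hD1r : (1 : ℝ) ≤ D := by exact_mod_cast hD1
  have hD0r : (0 : ℝ) < D := by linarith
  set x : ℝ := (D : ℝ) with hx
  set H : ℕ := D / 2 with hH
  set M : ℕ := 3 * ⌊x ^ τ⌋₊ with hM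
  set A : ℕ := ⌊Real.exp (x ^ β)⌋₊ with hA
  set N : ℕ := (H + 1) * (H + 1) with hN
  set ε : ℝ := Real.exp (-x ^ ν) / 2 with hε
  have hε0 : 0 < ε := by positivity
  have hε1 : ε ≤ 1 / 2 := by
    have : Real.exp (-x ^ ν) ≤ 1 := by
      rw [Real.exp_le_one_iff, neg_nonpos]; exact Real.rpow_nonneg hD0r.le _
    rw [hε]; linarith
  have hA1 : 1 ≤ A := Nat.le_floor (by simpa using Real.one_le_exp (Real.rpow_nonneg hD0r.le β))
  have hAexp : (A : ℝ) ≤ Real.exp (x ^ β) := Nat.floor_le (Real.exp_pos _).le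
  have hAexp' : Real.exp (x ^ β) ≤ (A : ℝ) + 1 := (Nat.lt_floor_add_one _).le
  have hHD : 2 * H ≤ D := by omega
  have hHD' : x ≤ 2 * ((H : ℝ) + 1) := by
    have : D ≤ 2 * (H + 1) := by omega
    rw [hx]; exact_mod_cast this
  have hN4 : x ^ 2 / 4 ≤ (N : ℝ) := by
    rw [hN]; push_cast
    have h0 : 0 ≤ (H : ℝ) + 1 := by positivity
    have h1 : x / 2 ≤ (H : ℝ) + 1 := by linarith
    have h2 : (x / 2) ^ 2 ≤ ((H : ℝ) + 1) ^ 2 := pow_le_pow_left₀ (by linarith) h1 2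
    nlinarith [h2]
  have hNx : (N : ℝ) ≤ (x + 1) ^ 2 := by
    rw [hN]; push_cast
    have h1 : (H : ℝ) ≤ x := by rw [hx]; exact_mod_cast (show H ≤ D by omega)
    have h0 : 0 ≤ (H : ℝ) + 1 := by positivity
    have h2 : ((H : ℝ) + 1) ^ 2 ≤ (x + 1) ^ 2 := pow_le_pow_left₀ h0 (by linarith) 2
    nlinarith [h2]
  have hN1 : (1 : ℝ) ≤ N := by rw [hN]; exact_mod_cast Nat.one_le_iff_ne_zero.2 (by positivity)
  have hMx : (M : ℝ) ≤ 3 * x ^ τ := by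
    rw [hM]; push_cast
    exact mul_le_mul_of_nonneg_left (Nat.floor_le (Real.rpow_nonneg hD0r.le τ)) (by norm_num)
  have hM0 : (0 : ℝ) ≤ M := Nat.cast_nonneg M
  -- the bound `B` on the values
  set B : ℝ := (N : ℝ) * A * M.factorial * R ^ D with hB
  have hB1 : 1 ≤ B := by
    rw [hB]
    have h1 : (1 : ℝ) ≤ A := by exact_mod_cast hA1
    have h2 : (1 : ℝ) ≤ M.factorial := by exact_mod_cast M.factorial_pos
    have h3 : (1 : ℝ) ≤ R ^ D := one_le_pow₀ hR1
    calc (1 : ℝ) = 1 * 1 * 1 * 1 := by ring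
      _ ≤ (N : ℝ) * A * M.factorial * R ^ D := by gcongr
  -- values of `𝒟₁ⁱ` on coefficient vectors
  let mono : Fin (H + 1) × Fin (H + 1) → MvPolynomial (Fin 2) ℤ :=
    fun k => X 0 ^ (k.1 : ℕ) * X 1 ^ (k.2 : ℕ)
  let val : (Fin (H + 1) × Fin (H + 1) → ℤ) → ℕ → ℂ :=
    fun d i => ∑ k : Fin (H + 1) × Fin (H + 1), (d k : ℂ) * aeval ![ξ, η] (royD^[i] (mono k))
  have hmono : ∀ k : Fin (H + 1) × Fin (H + 1), ∀ i < M,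
      ‖aeval ![ξ, η] (royD^[i] (mono k))‖ ≤ M.factorial * R ^ D := by
    intro k i hi
    have ha : (k.1 : ℕ) ≤ D := by have := k.1.is_lt; omega
    have hb : (k.2 : ℕ) ≤ D := by have := k.2.is_lt; omega
    refine (norm_aeval_iterate_royD_monomial_le ha hb ξ η i).trans ?_
    exact mul_le_mul_of_nonneg_right (by exact_mod_cast Nat.factorial_le hi.le)
      (pow_nonneg (by linarith) _)
  have hval : ∀ d : Fin (H + 1) × Fin (H + 1) → ℤ, (∀ k, |(d k : ℝ)| ≤ A) → ∀ i < M,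
      ‖val d i‖ ≤ B := by
    intro d hd i hi
    calc ‖val d i‖ ≤ ∑ k : Fin (H + 1) × Fin (H + 1), ‖(d k : ℂ) * aeval ![ξ, η] (royD^[i] (mono k))‖ :=
          norm_sum_le _ _
      _ ≤ ∑ _k : Fin (H + 1) × Fin (H + 1), (A : ℝ) * (M.factorial * R ^ D) := by
          refine Finset.sum_le_sum fun k _ => ?_
          rw [norm_mul]
          refine mul_le_mul ?_ (hmono k i hi) (norm_nonneg _) (Nat.cast_nonneg A)
          rw [Complex.norm_intCast]; exact hd k
      _ = B := by
          rw [Finset.sum_const, Finset.card_univ, nsmul_eq_mul, hB, hN]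
          simp [Fintype.card_prod, Fintype.card_fin]; ring
  -- cells
  set L : ℕ := ⌈B / ε⌉₊ with hL
  have hLB : B / ε ≤ L := Nat.le_ceil _
  let toZ : (Fin (H + 1) × Fin (H + 1) → Fin (A + 1)) → (Fin (H + 1) × Fin (H + 1) → ℤ) :=
    fun c k => ((c k : ℕ) : ℤ)
  have htoZ : ∀ c : Fin (H + 1) × Fin (H + 1) → Fin (A + 1), ∀ k, |((toZ c k : ℤ) : ℝ)| ≤ A := by
    intro c k
    have h1 : ((c k : ℕ) : ℝ) ≤ A := by exact_mod_cast Nat.lt_succ_iff.1 (c k).is_lt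
    have h0 : (0 : ℝ) ≤ ((c k : ℕ) : ℝ) := Nat.cast_nonneg _
    simp only [toZ, Int.cast_natCast, abs_of_nonneg h0]
    exact h1
  let cell : (Fin (H + 1) × Fin (H + 1) → Fin (A + 1)) → (Fin M → ℤ × ℤ) :=
    fun c i => (⌊(val (toZ c) i).re / ε⌋, ⌊(val (toZ c) i).im / ε⌋)
  let T : Finset (Fin M → ℤ × ℤ) :=
    Fintype.piFinset fun _ => (Finset.Icc (-(L : ℤ)) L) ×ˢ (Finset.Icc (-(L : ℤ)) L)
  have hbox : ∀ t : ℝ, |t| ≤ B → ⌊t / ε⌋ ∈ Finset.Icc (-(L : ℤ)) L := by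
    intro t ht
    rw [Finset.mem_Icc]
    have ht1 : t ≤ B := (le_abs_self t).trans ht
    have ht2 : -B ≤ t := by have := neg_abs_le t; linarith
    have hup : t / ε ≤ L := (div_le_div_of_nonneg_right ht1 hε0.le).trans hLB
    have hlo : -(L : ℝ) ≤ t / ε := by
      have h' : -B / ε ≤ t / ε := div_le_div_of_nonneg_right (by linarith) hε0.le
      calc -(L : ℝ) ≤ -(B / ε) := by linarith
        _ = -B / ε := by ring
        _ ≤ t / ε := h'
    constructor
    · rw [Int.le_floor]; push_cast; exact hlo
    · calc ⌊t / ε⌋ ≤ ⌊((L : ℤ) : ℝ)⌋ := Int.floor_mono (by push_cast; exact hup)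
        _ = L := Int.floor_intCast _
  have hcellT : Set.MapsTo cell
      (↑(Finset.univ : Finset (Fin (H + 1) × Fin (H + 1) → Fin (A + 1)))) (↑T) := by
    intro c _
    rw [Finset.mem_coe]
    simp only [T, Fintype.mem_piFinset]
    intro i
    rw [Finset.mem_product]
    have hvi : ‖val (toZ c) i‖ ≤ B := hval (toZ c) (htoZ c) i i.is_lt
    exact ⟨hbox _ ((Complex.abs_re_le_norm _).trans hvi), hbox _ ((Complex.abs_im_le_norm _).trans hvi)⟩
  -- counting
  have hcardT : T.card = ((2 * L + 1) * (2 * L + 1)) ^ M := by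
    simp only [T, Fintype.card_piFinset, Finset.prod_const, Finset.card_univ, Fintype.card_fin,
      Finset.card_product, Int.card_Icc]
    congr 2 <;> omega
  have hcardU : (Finset.univ : Finset (Fin (H + 1) × Fin (H + 1) → Fin (A + 1))).card = (A + 1) ^ N := by
    rw [Finset.card_univ, Fintype.card_fun, Fintype.card_fin, Fintype.card_prod, Fintype.card_fin, hN]
  -- the main inequality, in ℝ
  have hlogN : Real.log N ≤ 2 * x := by
    have h1 : Real.log N ≤ Real.log ((x + 1) ^ 2) := Real.log_le_log (by linarith) hNx
    have h2 : Real.log (x + 1) ≤ x := by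
      have := Real.log_le_sub_one_of_pos (show 0 < x + 1 by linarith); linarith
    rw [Real.log_pow] at h1; push_cast at h1; linarith
  have hlogA : Real.log A ≤ x ^ β := (Real.log_le_iff_le_exp (by exact_mod_cast hA1)).2 hAexp
  have hlogfact : Real.log (M.factorial) ≤ M * Real.log M := by
    have h1 : (M.factorial : ℝ) ≤ (M : ℝ) ^ M := by exact_mod_cast Nat.factorial_le_pow M
    calc Real.log (M.factorial) ≤ Real.log ((M : ℝ) ^ M) :=
          Real.log_le_log (by exact_mod_cast M.factorial_pos) h1
      _ = M * Real.log M := Real.log_pow _ _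
  have hlogx : 0 ≤ Real.log x := Real.log_nonneg hD1r
  have hlog8 : 0 ≤ Real.log 8 := Real.log_nonneg (by norm_num)
  have hlog3 : 0 ≤ Real.log 3 := Real.log_nonneg (by norm_num)
  have hMlogM : (M : ℝ) * Real.log M ≤ 3 * x ^ τ * (Real.log 3 + τ * Real.log x) := by
    have hrhs : 0 ≤ Real.log 3 + τ * Real.log x := by positivity
    rcases Nat.eq_zero_or_pos M with hM0' | hMpos
    · rw [hM0']; simp; positivity
    · have hM1 : (0 : ℝ) < M := by exact_mod_cast hMpos
      have hlogM : Real.log M ≤ Real.log 3 + τ * Real.log x := by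
        calc Real.log M ≤ Real.log (3 * x ^ τ) := Real.log_le_log hM1 hMx
          _ = Real.log 3 + τ * Real.log x := by
              rw [Real.log_mul (by norm_num) (by positivity), Real.log_rpow hD0r]
      calc (M : ℝ) * Real.log M ≤ M * (Real.log 3 + τ * Real.log x) :=
            mul_le_mul_of_nonneg_left hlogM hM0
        _ ≤ 3 * x ^ τ * (Real.log 3 + τ * Real.log x) := mul_le_mul_of_nonneg_right hMx hrhs
  have hMlogM0 : 0 ≤ (M : ℝ) * Real.log M := by
    rcases Nat.eq_zero_or_pos M with hM0' | hMpos
    · rw [hM0']; simp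
    · exact mul_nonneg hM0 (Real.log_nonneg (by exact_mod_cast hMpos))
  have hlog8B : Real.log (8 * B) ≤ Real.log 8 + 2 * x + x ^ β + M * Real.log M + x * Real.log R := by
    rw [hB, Real.log_mul (by norm_num) (by positivity), Real.log_mul (by positivity) (by positivity),
      Real.log_mul (by positivity) (by positivity), Real.log_mul (by positivity) (by positivity),
      Real.log_pow]
    linarith
  -- powers of x
  have hxτ1 : x ^ τ * x = x ^ (τ + 1) := by rw [Real.rpow_add hD0r, Real.rpow_one]
  have hxτβ : x ^ τ * x ^ β = x ^ (τ + β) := by rw [Real.rpow_add hD0r]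
  have hx2τ : x ^ τ * x ^ τ = x ^ (2 * τ) := by rw [← Real.rpow_add hD0r]; ring_nf
  have hxτν : x ^ τ * x ^ ν = x ^ (τ + ν) := by rw [Real.rpow_add hD0r]
  have hx2β : x ^ 2 * x ^ β = x ^ (2 + β) := by
    rw [Real.rpow_add hD0r, Real.rpow_two]
  have hxτ0 : 0 ≤ x ^ τ := Real.rpow_nonneg hD0r.le τ
  have hxν0 : 0 ≤ x ^ ν := Real.rpow_nonneg hD0r.le ν
  have hxβ0 : 0 ≤ x ^ β := Real.rpow_nonneg hD0r.le β
  have hx2β0 : 0 < x ^ (2 + β) := Real.rpow_pos_of_pos hD0r _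
  have hS : 2 * M * (Real.log (8 * B) + x ^ ν) < N * x ^ β := by
    have t1 : 2 * M * Real.log 8 ≤ 6 * Real.log 8 * x ^ τ := by
      have := mul_le_mul_of_nonneg_right hMx hlog8; linarith only [this]
    have t2 : 2 * M * (2 * x) ≤ 12 * x ^ (τ + 1) := by
      rw [← hxτ1]; have := mul_le_mul_of_nonneg_right hMx hD0r.le; linarith only [this]
    have t3 : 2 * M * x ^ β ≤ 6 * x ^ (τ + β) := by
      rw [← hxτβ]; have := mul_le_mul_of_nonneg_right hMx hxβ0; linarith only [this]
    have t45 : 2 * M * (M * Real.log M) ≤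
        18 * Real.log 3 * x ^ (2 * τ) + 18 * τ * x ^ (2 * τ) * Real.log x := by
      calc 2 * M * (M * Real.log M) ≤ 2 * (3 * x ^ τ) * (3 * x ^ τ * (Real.log 3 + τ * Real.log x)) :=
            mul_le_mul (by linarith only [hMx]) hMlogM hMlogM0 (by positivity)
        _ = 18 * Real.log 3 * (x ^ τ * x ^ τ) + 18 * τ * (x ^ τ * x ^ τ) * Real.log x := by ring
        _ = _ := by rw [hx2τ]
    have t6 : 2 * M * (x * Real.log R) ≤ 6 * Real.log R * x ^ (τ + 1) := by
      rw [← hxτ1]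
      have := mul_le_mul_of_nonneg_right hMx (mul_nonneg hD0r.le hlogR); linarith only [this]
    have t7 : 2 * M * x ^ ν ≤ 6 * x ^ (τ + ν) := by
      rw [← hxτν]; have := mul_le_mul_of_nonneg_right hMx hxν0; linarith only [this]
    have hsum : 2 * M * (Real.log (8 * B) + x ^ ν) ≤ 7 * (1 / 56 * x ^ (2 + β)) := by
      calc 2 * M * (Real.log (8 * B) + x ^ ν)
          ≤ 2 * M * (Real.log 8 + 2 * x + x ^ β + M * Real.log M + x * Real.log R + x ^ ν) := by
            apply mul_le_mul_of_nonneg_left _ (by positivity); linarith only [hlog8B]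
        _ = 2 * M * Real.log 8 + 2 * M * (2 * x) + 2 * M * x ^ β + 2 * M * (M * Real.log M) +
              2 * M * (x * Real.log R) + 2 * M * x ^ ν := by ring
        _ ≤ 7 * (1 / 56 * x ^ (2 + β)) := by
            linarith only [t1, t2, t3, t45, t6, t7, e1, e2, e3, e4, e5, e6, e7]
    calc 2 * M * (Real.log (8 * B) + x ^ ν) ≤ 7 * (1 / 56 * x ^ (2 + β)) := hsum
      _ < x ^ 2 / 4 * x ^ β := by
          have h4 : x ^ 2 / 4 * x ^ β = x ^ (2 + β) / 4 := by rw [← hx2β]; ring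
          rw [h4]; linarith only [hx2β0]
      _ ≤ N * x ^ β := mul_le_mul_of_nonneg_right hN4 hxβ0
  have h2L : (2 * (L : ℝ) + 1) ≤ 4 * B / ε := by
    have h1 : (L : ℝ) < B / ε + 1 := Nat.ceil_lt_add_one (by positivity)
    have h2 : 2 ≤ B / ε := by
      rw [le_div_iff₀ hε0]; linarith only [hB1, hε1]
    have h3 : 4 * B / ε = 4 * (B / ε) := by ring
    rw [h3]; linarith only [h1, h2]
  have hcount : T.card < (Finset.univ : Finset (Fin (H + 1) × Fin (H + 1) → Fin (A + 1))).card := by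
    rw [hcardT, hcardU]
    have hεexp : 4 * B / ε = Real.exp (Real.log (8 * B) + x ^ ν) := by
      rw [Real.exp_add, Real.exp_log (by positivity), hε, Real.exp_neg]
      field_simp
      ring
    have hreal : (((2 * L + 1) * (2 * L + 1) : ℕ) : ℝ) ^ M < (((A + 1 : ℕ) : ℝ)) ^ N := by
      have hL0 : (0 : ℝ) ≤ 2 * L + 1 := by positivity
      calc (((2 * L + 1) * (2 * L + 1) : ℕ) : ℝ) ^ M = ((2 * (L : ℝ) + 1) ^ 2) ^ M := by push_cast; ring
        _ ≤ ((4 * B / ε) ^ 2) ^ M := by gcongr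
        _ = (4 * B / ε) ^ (2 * M) := by rw [← pow_mul]
        _ = Real.exp (Real.log (8 * B) + x ^ ν) ^ (2 * M) := by rw [hεexp]
        _ = Real.exp ((2 * M : ℕ) * (Real.log (8 * B) + x ^ ν)) := (Real.exp_nat_mul _ _).symm
        _ = Real.exp (2 * M * (Real.log (8 * B) + x ^ ν)) := by push_cast; ring_nf
        _ < Real.exp (N * x ^ β) := Real.exp_lt_exp.2 hS
        _ = Real.exp (x ^ β) ^ N := Real.exp_nat_mul _ _
        _ ≤ (((A + 1 : ℕ) : ℝ)) ^ N := by
            gcongr; push_cast; exact hAexp'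
    exact_mod_cast hreal
  -- pigeonhole
  obtain ⟨c₁, -, c₂, -, hne, hcell⟩ := Finset.exists_ne_map_eq_of_card_lt_of_maps_to hcount hcellT
  -- the polynomial
  let d : Fin (H + 1) × Fin (H + 1) → ℤ := fun k => toZ c₁ k - toZ c₂ k
  have hdA : ∀ k, (d k).natAbs ≤ A := by
    intro k
    have h1 := (c₁ k).is_lt; have h2 := (c₂ k).is_lt
    simp only [d, toZ]; omega
  refine ⟨∑ k : Fin (H + 1) × Fin (H + 1), C (d k) * (X 0 ^ (k.1 : ℕ) * X 1 ^ (k.2 : ℕ)),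
    ?_, ?_, ?_, ?_⟩
  · -- nonzero
    obtain ⟨k₀, hk₀⟩ : ∃ k₀, c₁ k₀ ≠ c₂ k₀ := Function.ne_iff.mp hne
    intro hP
    have hc := congrArg (coeff (Finsupp.single (0 : Fin 2) (k₀.1 : ℕ) + Finsupp.single 1 (k₀.2 : ℕ))) hP
    rw [coeff_boxPoly_self, coeff_zero] at hc
    apply hk₀
    have h' : ((c₁ k₀ : ℕ) : ℤ) = ((c₂ k₀ : ℕ) : ℤ) := by simp only [d, toZ] at hc; omega
    exact Fin.ext (by exact_mod_cast h')
  · -- degree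
    exact (totalDegree_boxPoly_le d).trans hHD
  · -- height
    have hh : mvPolyHeight (∑ k : Fin (H + 1) × Fin (H + 1),
        C (d k) * (X 0 ^ (k.1 : ℕ) * X 1 ^ (k.2 : ℕ)) : MvPolynomial (Fin 2) ℤ) ≤ A :=
      Finset.sup_le fun m _ => natAbs_coeff_boxPoly_le d hdA m
    calc _ ≤ (A : ℝ) := by exact_mod_cast hh
      _ ≤ Real.exp (x ^ β) := hAexp
  · -- values
    intro i hi
    rw [aeval_iterate_royD_boxPoly]
    have hsplit : (∑ k : Fin (H + 1) × Fin (H + 1),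
        (d k : ℂ) * aeval ![ξ, η] (royD^[i] (X 0 ^ (k.1 : ℕ) * X 1 ^ (k.2 : ℕ)))) =
        val (toZ c₁) i - val (toZ c₂) i := by
      simp only [val, mono, d, ← Finset.sum_sub_distrib]
      refine Finset.sum_congr rfl fun k _ => ?_
      push_cast; ring
    rw [hsplit]
    have hci := congrFun hcell ⟨i, hi⟩
    have hre : |(val (toZ c₁) i - val (toZ c₂) i).re| < ε := by
      rw [Complex.sub_re]; exact abs_sub_lt_of_floor_div_eq hε0 (congrArg Prod.fst hci)
    have him : |(val (toZ c₁) i - val (toZ c₂) i).im| < ε := by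
      rw [Complex.sub_im]; exact abs_sub_lt_of_floor_div_eq hε0 (congrArg Prod.snd hci)
    calc ‖val (toZ c₁) i - val (toZ c₂) i‖
        ≤ |(val (toZ c₁) i - val (toZ c₂) i).re| + |(val (toZ c₁) i - val (toZ c₂) i).im| :=
          Complex.norm_le_abs_re_add_abs_im _
      _ ≤ ε + ε := add_le_add hre.le him.le
      _ = Real.exp (-x ^ ν) := by rw [hε]; ring

/-- **Tightness of the crux — the `ν`-bound cannot be lowered at all**: for every `1 ≤ τ < 2`,
`β > τ` and EVERY `ν < 2 + β − τ` the crux-shaped implication fails at the transcendental point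
`(e, 1)`. [cite: Roy2013, p. 3] -/
theorem roySmallValueDirichletGap_false_below_edge {β τ ν : ℝ} (h1 : 1 ≤ τ) (h2 : τ < 2) (hβ : τ < β)
    (hν : ν < 2 + β - τ) :
    ¬ (∀ (ξ η : ℂ), η ≠ 0 →
      (∀ᶠ D : ℕ in Filter.atTop, ∃ P : MvPolynomial (Fin 2) ℤ, P ≠ 0 ∧ P.totalDegree ≤ D ∧
        (mvPolyHeight P : ℝ) ≤ Real.exp ((D : ℝ) ^ β) ∧
        ∀ i : ℕ, i < 3 * ⌊(D : ℝ) ^ τ⌋₊ →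
          ‖MvPolynomial.aeval ![ξ, η] (royD^[i] P)‖ ≤ Real.exp (-(D : ℝ) ^ ν)) →
      IsAlgebraic ℚ ξ ∧ IsAlgebraic ℚ η) := fun h =>
  transcendental_exp_holds isAlgebraic_one one_ne_zero
    (h (cexp 1) 1 one_ne_zero (hyp_below_edge _ _ h1 h2 hβ hν)).1

/-- **The crux with its window lowered below the edge is false**: replacing the hypothesis
`2 + β − τ < ν` of `RoySmallValueDirichletGap` by `2 + β − τ − δ < ν` for any fixed `δ > 0` gives a
false statement. [cite: Roy2013, p. 3] -/
theorem roySmallValueDirichletGap_false_of_edge_lowered {δ : ℝ} (hδ : 0 < δ) :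
    ¬ (∀ (ξ η : ℂ), η ≠ 0 → ∀ (β τ ν : ℝ), 1 ≤ τ → τ < 2 → τ < β → 2 + β - τ - δ < ν →
      (∀ᶠ D : ℕ in Filter.atTop, ∃ P : MvPolynomial (Fin 2) ℤ, P ≠ 0 ∧ P.totalDegree ≤ D ∧
        (mvPolyHeight P : ℝ) ≤ Real.exp ((D : ℝ) ^ β) ∧
        ∀ i : ℕ, i < 3 * ⌊(D : ℝ) ^ τ⌋₊ →
          ‖MvPolynomial.aeval ![ξ, η] (royD^[i] P)‖ ≤ Real.exp (-(D : ℝ) ^ ν)) →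
      IsAlgebraic ℚ ξ ∧ IsAlgebraic ℚ η) := fun h =>
  roySmallValueDirichletGap_false_below_edge (β := 2) (τ := 1) (ν := 3 - δ / 2) le_rfl (by norm_num)
    (by norm_num) (by linarith) fun ξ η hη hP =>
      h ξ η hη 2 1 (3 - δ / 2) le_rfl (by norm_num) (by norm_num) (by linarith) hP

end Summit.Schanuel.Schanuel.Theorems.RoySmallValueDirichletGapDirichlet

end
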